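import Summits.Ventures.LatticeQCDFlow.Scaling.SimulatedTemperingLevelKernel

/-!
HONEST FRAMING: exact (Metropolis-corrected) sampling algorithms for lattice gauge theory; figures
of merit are autocorrelation/cost numbers at stated couplings and volumes; no continuum-physics
claim.

# SimulatedTemperingWithinLevel — THE WITHIN-LEVEL SWEEP OF SIMULATED TEMPERING (ANY FAMILY OF
# `μ_{β_k}`-INVARIANT MARKOV KERNELS APPLIED AT THE CURRENT LEVEL) AND THE RANDOM-SCAN MIXTURE OF TWO KERNELS,
# AS MARKOV KERNELS: LEVEL PRESERVATION, INVARIANCE AND DETAILED BALANCE (lean-2 GEN-14, ours)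

Venture-side (OURS).  Cell `lqcd-flow` (pub-lqcd), unit `pub-lqcd-lean-2-g14`, 2026-08-24.  The second
ingredient of the simulated-tempering ALGORITHM (the first, the exact-weight Metropolis level move, is
`Scaling/SimulatedTemperingLevelKernel{,Balance}`): at level `k` the configuration `x ∈ Ω` is updated by a
Markov kernel `M k` on `Ω` that leaves `μ_{β_k} = μ.tilted(β_k·X)` invariant — heat bath / over-relaxation /
HMC / a Metropolis-corrected flow proposal at coupling `β_k`, anything exact.  GEN-13's composition theorem
(`Scaling/SimulatedTemperingComposition`) took such a "within-level dynamics" abstractly as a LEVEL-PRESERVING,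
TARGET-INVARIANT Markov kernel `M` on `Fin (K+1) × Ω`; here that kernel is CONSTRUCTED from the family
`(M k)_k` and both properties are PROVED, together with detailed balance when every `M k` is
`μ_{β_k}`-reversible.  The random-scan combination ("with probability `t` move the level, else sweep") is the
mixture kernel `mixtureKernel t κ η = t·κ + (1−t)·η`, typed here on a general measurable space (Mathlib
`Kernel`) with its invariance / reversibility / Markov closure properties — the general-state-space counterpart of
row 9's finite-state `Exactness/KernelMixture.mixKernel` (matrix kernels, `Fintype` state space).

## What is defined / proved

* §1 (`M : Fin (K+1) → Kernel Ω Ω`): `stWithinLevelMeasure`, **`stWithinLevel M`** — the kernel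
  `(k, x) ↦ δ_k ⊗ M k(x, ·)` on `Fin (K+1) × Ω` (`stWithinLevel_apply'`: `W(k,x)(S) = M k x {x' | (k,x') ∈ S}`);
  `IsMarkovKernel` when every `M k` is; `lintegral_stWithinLevel`; **`stWithinLevel_levelPreserving`** —
  `W(y){level ≠ level(y)} = 0` (hypothesis `hM` of `st_level_lagOneAutocorr_ge_comp`);
  `setLIntegral_stTarget_level` (`∫⁻_A f dπ = (K+1)⁻¹Σ_k ∫⁻_{A_k} f(k,·) dμ_{β_k}`);
  **`invariant_stWithinLevel`** — every `M k` leaves `μ_{β_k}` invariant ⇒ `W` leaves `stTarget X μ β K`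
  invariant; **`isReversible_stWithinLevel`** — every `M k` is `μ_{β_k}`-reversible ⇒ `W` is
  `stTarget`-reversible.
* §2 (general measurable `E`, `t ∈ [0,1]` as `t : unitInterval`, kernels `κ η : Kernel E E`): `mixtureMeasure`,
  **`mixtureKernel t κ η`** (`= t·κ + (1−t)·η` pointwise), `mixtureKernel_apply'`, `IsMarkovKernel`,
  `lintegral_mixtureKernel`; **`invariant_mixtureKernel`** (both invariant ⇒ mixture invariant),
  **`isReversible_mixtureKernel`** (both reversible ⇒ mixture reversible); `mixtureKernel_null` (a set null for both
  is null for the mixture — transfers a.e. statements such as nearest-neighbour moves); `mixtureKernel_real`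
  (`(t·κ + (1−t)·η)(z)(S)` in `ℝ`).

NOT CLAIMED: irreducibility / ergodicity of the resulting samplers (depends on the `M k`); anything measured.
Literature grade (cell rule): TEXTBOOK (hybrid kernels: Tierney, Ann. Statist. 22 (1994) 1701, §2.4 — mixtures
and cycles of invariant kernels are invariant; Geyer–Thompson 1995 for simulated tempering), NEW TYPING (Mathlib
`Kernel` on `Fin (K+1) × Ω`); nothing cited as a fact; no new bib keys.
-/

noncomputable section

open MeasureTheory ProbabilityTheory Set Filter Finset
open scoped ENNReal

namespace Summit.Ventures.LatticeQCDFlow.Scaling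

/-! ## §1 The within-level kernel built from a family `M k` of kernels on `Ω` -/

section WithinLevel

variable {Ω : Type*} [MeasurableSpace Ω] {K : ℕ}

/-- The transition measure of the within-level sweep from `(k, x)`: `δ_k ⊗ M k(x, ·)`, i.e. the push-forward of
`M k x` under `x' ↦ (k, x')`. [ours] -/
def stWithinLevelMeasure (M : Fin (K + 1) → Kernel Ω Ω) (z : Fin (K + 1) × Ω) : Measure (Fin (K + 1) × Ω) :=
  (M z.1 z.2).map (Prod.mk z.1)

/-- Measurability of `z ↦ δ_{z.1} ⊗ M z.1 (z.2, ·)` (the level set is countable). [ours] -/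
theorem measurable_stWithinLevelMeasure (M : Fin (K + 1) → Kernel Ω Ω) : Measurable (stWithinLevelMeasure M) := by
  refine Measure.measurable_of_measurable_coe _ fun s hs => ?_
  refine measurable_from_prod_countable_right fun k => ?_
  simp only [stWithinLevelMeasure, Measure.map_apply measurable_prodMk_left hs]
  exact (M k).measurable_coe (measurable_prodMk_left hs)

/-- **THE WITHIN-LEVEL KERNEL** `W = stWithinLevel M` on `Fin (K+1) × Ω`: at level `k` update `x` by `M k`, keep
`k`. [ours] -/
def stWithinLevel (M : Fin (K + 1) → Kernel Ω Ω) : Kernel (Fin (K + 1) × Ω) (Fin (K + 1) × Ω) :=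
  ⟨stWithinLevelMeasure M, measurable_stWithinLevelMeasure M⟩

/-- `W(z) = (M z.1 z.2).map (Prod.mk z.1)`. [ours] -/
theorem stWithinLevel_apply (M : Fin (K + 1) → Kernel Ω Ω) (z : Fin (K + 1) × Ω) :
    stWithinLevel M z = (M z.1 z.2).map (Prod.mk z.1) := rfl

/-- `W(k,x)(S) = M k x {x' | (k, x') ∈ S}` for measurable `S`. [ours] -/
theorem stWithinLevel_apply' (M : Fin (K + 1) → Kernel Ω Ω) (z : Fin (K + 1) × Ω) {s : Set (Fin (K + 1) × Ω)}
    (hs : MeasurableSet s) : stWithinLevel M z s = M z.1 z.2 (Prod.mk z.1 ⁻¹' s) := by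
  rw [stWithinLevel_apply, Measure.map_apply measurable_prodMk_left hs]

/-- `W` is Markov when every `M k` is. [ours] -/
instance isMarkovKernel_stWithinLevel (M : Fin (K + 1) → Kernel Ω Ω) [∀ k, IsMarkovKernel (M k)] :
    IsMarkovKernel (stWithinLevel M) :=
  ⟨fun z => by
    rw [stWithinLevel_apply]
    exact Measure.isProbabilityMeasure_map measurable_prodMk_left.aemeasurable⟩

/-- Integration against `W`: `∫⁻ g dW(z) = ∫⁻ g(z.1, x') dM z.1 (z.2, dx')`. [ours] -/
theorem lintegral_stWithinLevel (M : Fin (K + 1) → Kernel Ω Ω) {g : Fin (K + 1) × Ω → ℝ≥0∞} (hg : Measurable g)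
    (z : Fin (K + 1) × Ω) : ∫⁻ y, g y ∂(stWithinLevel M z) = ∫⁻ x', g (z.1, x') ∂(M z.1 z.2) := by
  rw [stWithinLevel_apply, lintegral_map hg measurable_prodMk_left]

/-- **`W` PRESERVES THE LEVEL**: `W(y){y' | level(y') ≠ level(y)} = 0` — hypothesis `hM` of GEN-13's
composition theorem `st_level_lagOneAutocorr_ge_comp`. [ours] -/
theorem stWithinLevel_levelPreserving (M : Fin (K + 1) → Kernel Ω Ω) (y : Fin (K + 1) × Ω) :
    stWithinLevel M y {y' | ((y'.1 : Fin (K + 1)) : ℕ) ≠ ((y.1 : Fin (K + 1)) : ℕ)} = 0 := by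
  set S : Set (Fin (K + 1) × Ω) := {y' | ((y'.1 : Fin (K + 1)) : ℕ) ≠ ((y.1 : Fin (K + 1)) : ℕ)} with hS_def
  have e : S = (fun y' : Fin (K + 1) × Ω => ((y'.1 : Fin (K + 1)) : ℕ)) ⁻¹' {n : ℕ | n ≠ ((y.1 : Fin (K + 1)) : ℕ)} := by
    ext y'; simp [hS_def]
  have hS : MeasurableSet S := by rw [e]; exact measurable_stLevel MeasurableSet.of_discrete
  rw [stWithinLevel_apply' M y hS]
  have h0 : Prod.mk y.1 ⁻¹' S = ∅ := by
    ext x; simp [hS_def]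
  rw [h0, measure_empty]

variable {X : Ω → ℝ} {μ : Measure Ω} {β : ℕ → ℝ}

/-- Set integrals against the simulated-tempering target, level by level:
`∫⁻_A f dπ = (K+1)⁻¹·Σ_k ∫⁻_{x : (k,x) ∈ A} f(k, x) dμ_{β_k}`. [ours] -/
theorem setLIntegral_stTarget_level {f : Fin (K + 1) × Ω → ℝ≥0∞} (hf : Measurable f) {A : Set (Fin (K + 1) × Ω)}
    (hA : MeasurableSet A) :
    ∫⁻ z in A, f z ∂(stTarget X μ β K) = ((K + 1 : ℕ) : ℝ≥0∞)⁻¹ *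
      ∑ k : Fin (K + 1), ∫⁻ x in Prod.mk k ⁻¹' A, f (k, x) ∂(μ.tilted fun x => β k * X x) := by
  rw [← lintegral_indicator hA, lintegral_stTarget (hf.indicator hA)]
  congr 1
  refine Finset.sum_congr rfl fun k _ => ?_
  rw [← lintegral_indicator (measurable_prodMk_left hA)]
  exact lintegral_congr fun x => (Set.indicator_comp_right (Prod.mk k)).symm

/-- **`W` LEAVES THE EXACT-WEIGHT TARGET INVARIANT** as soon as every `M k` leaves `μ_{β_k}` invariant — the
within-level updates are exact at their own coupling. [ours] -/
theorem invariant_stWithinLevel (M : Fin (K + 1) → Kernel Ω Ω)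
    (hM : ∀ k : Fin (K + 1), Kernel.Invariant (M k) (μ.tilted fun x => β k * X x)) :
    Kernel.Invariant (stWithinLevel M) (stTarget X μ β K) := by
  unfold Kernel.Invariant
  ext A hA
  rw [Measure.bind_apply hA (Kernel.aemeasurable _), lintegral_stTarget ((stWithinLevel M).measurable_coe hA)]
  have h : ∀ k : Fin (K + 1), ∫⁻ x, stWithinLevel M (k, x) A ∂(μ.tilted fun x => β k * X x) =
      (μ.tilted fun x => β k * X x) (Prod.mk k ⁻¹' A) := by
    intro k
    simp only [stWithinLevel_apply' M _ hA]
    rw [← Measure.bind_apply (measurable_prodMk_left hA) (Kernel.aemeasurable _)]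
    exact congrFun (congrArg DFunLike.coe (hM k).def) _
  simp only [h]
  simp only [stTarget, Measure.smul_apply, Measure.coe_finsetSum, Finset.sum_apply,
    Measure.map_apply measurable_prodMk_left hA, smul_eq_mul]

/-- **`W` IS REVERSIBLE WITH RESPECT TO THE EXACT-WEIGHT TARGET** as soon as every `M k` is
`μ_{β_k}`-reversible (heat bath, Metropolis, Metropolis-corrected flow proposals …). [ours] -/
theorem isReversible_stWithinLevel (M : Fin (K + 1) → Kernel Ω Ω)
    (hM : ∀ k : Fin (K + 1), Kernel.IsReversible (M k) (μ.tilted fun x => β k * X x)) :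
    Kernel.IsReversible (stWithinLevel M) (stTarget X μ β K) := by
  intro A B hA hB
  rw [setLIntegral_stTarget_level ((stWithinLevel M).measurable_coe hB) hA,
    setLIntegral_stTarget_level ((stWithinLevel M).measurable_coe hA) hB]
  congr 1
  refine Finset.sum_congr rfl fun k _ => ?_
  simp only [stWithinLevel_apply' M _ hB, stWithinLevel_apply' M _ hA]
  exact hM k (measurable_prodMk_left hA) (measurable_prodMk_left hB)

end WithinLevel

/-! ## §2 The random-scan mixture of two kernels -/

section Mixture

variable {E : Type*} [MeasurableSpace E]

/-- The transition measure of the mixture: `t·κ(z) + (1−t)·η(z)`. [ours] -/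
def mixtureMeasure (t : unitInterval) (κ η : Kernel E E) (z : E) : Measure E :=
  ENNReal.ofReal (t : ℝ) • κ z + ENNReal.ofReal (1 - (t : ℝ)) • η z

/-- The mixture on a set. [ours] -/
theorem mixtureMeasure_apply (t : unitInterval) (κ η : Kernel E E) (z : E) (s : Set E) :
    mixtureMeasure t κ η z s = ENNReal.ofReal (t : ℝ) * κ z s + ENNReal.ofReal (1 - (t : ℝ)) * η z s := by
  simp only [mixtureMeasure, Measure.coe_add, Measure.coe_smul, Pi.add_apply, Pi.smul_apply, smul_eq_mul]

/-- Measurability of `z ↦ t·κ(z) + (1−t)·η(z)`. [ours] -/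
theorem measurable_mixtureMeasure (t : unitInterval) (κ η : Kernel E E) : Measurable (mixtureMeasure t κ η) := by
  refine Measure.measurable_of_measurable_coe _ fun s hs => ?_
  simp only [mixtureMeasure_apply]
  exact ((κ.measurable_coe hs).const_mul _).add ((η.measurable_coe hs).const_mul _)

/-- **THE RANDOM-SCAN MIXTURE KERNEL** `mixtureKernel t κ η = t·κ + (1−t)·η` (`t ∈ [0,1]`): with probability `t` make
a `κ`-step, else an `η`-step. [ours] -/
def mixtureKernel (t : unitInterval) (κ η : Kernel E E) : Kernel E E :=
  ⟨mixtureMeasure t κ η, measurable_mixtureMeasure t κ η⟩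

/-- The mixture kernel on a set. [ours] -/
theorem mixtureKernel_apply' (t : unitInterval) (κ η : Kernel E E) (z : E) (s : Set E) :
    mixtureKernel t κ η z s = ENNReal.ofReal (t : ℝ) * κ z s + ENNReal.ofReal (1 - (t : ℝ)) * η z s :=
  mixtureMeasure_apply t κ η z s

/-- The two weights sum to one. [folklore] -/
theorem mixture_weights (t : unitInterval) : ENNReal.ofReal (t : ℝ) + ENNReal.ofReal (1 - (t : ℝ)) = 1 := by
  rw [← ENNReal.ofReal_add t.2.1 (sub_nonneg.2 t.2.2), add_sub_cancel, ENNReal.ofReal_one]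

/-- The mixture of Markov kernels is Markov. [ours] -/
instance isMarkovKernel_mixtureKernel (t : unitInterval) (κ η : Kernel E E) [IsMarkovKernel κ] [IsMarkovKernel η] :
    IsMarkovKernel (mixtureKernel t κ η) :=
  ⟨fun z => ⟨by rw [mixtureKernel_apply', measure_univ, measure_univ, mul_one, mul_one, mixture_weights]⟩⟩

/-- Integration against the mixture: `∫⁻ g d(t·κ + (1−t)·η)(z) = t·∫⁻ g dκ(z) + (1−t)·∫⁻ g dη(z)`. [ours] -/
theorem lintegral_mixtureKernel (t : unitInterval) (κ η : Kernel E E) (g : E → ℝ≥0∞) (z : E) :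
    ∫⁻ y, g y ∂(mixtureKernel t κ η z) =
      ENNReal.ofReal (t : ℝ) * ∫⁻ y, g y ∂(κ z) + ENNReal.ofReal (1 - (t : ℝ)) * ∫⁻ y, g y ∂(η z) := by
  show ∫⁻ y, g y ∂(mixtureMeasure t κ η z) = _
  simp only [mixtureMeasure, lintegral_add_measure, lintegral_smul_measure, smul_eq_mul]

/-- A set that is null for both components is null for the mixture (transfers `κ(z,·)`-a.e. statements, e.g.
nearest-neighbour level moves). [ours] -/
theorem mixtureKernel_null (t : unitInterval) (κ η : Kernel E E) (z : E) {s : Set E} (hκ : κ z s = 0)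
    (hη : η z s = 0) : mixtureKernel t κ η z s = 0 := by
  rw [mixtureKernel_apply', hκ, hη, mul_zero, mul_zero, add_zero]

/-- The mixture on a set, in `ℝ` (for finite kernels). [ours] -/
theorem mixtureKernel_real (t : unitInterval) (κ η : Kernel E E) [IsMarkovKernel κ] [IsMarkovKernel η] (z : E)
    (s : Set E) : (mixtureKernel t κ η z).real s = (t : ℝ) * (κ z).real s + (1 - (t : ℝ)) * (η z).real s := by
  rw [measureReal_def, mixtureKernel_apply', ENNReal.toReal_add (ENNReal.mul_ne_top ENNReal.ofReal_ne_top
    (measure_ne_top _ _)) (ENNReal.mul_ne_top ENNReal.ofReal_ne_top (measure_ne_top _ _)),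
    ENNReal.toReal_mul, ENNReal.toReal_mul, ENNReal.toReal_ofReal t.2.1,
    ENNReal.toReal_ofReal (sub_nonneg.2 t.2.2), measureReal_def, measureReal_def]

/-- **MIXTURES OF INVARIANT KERNELS ARE INVARIANT.** [folklore: Tierney 1994 §2.4] -/
theorem invariant_mixtureKernel (t : unitInterval) {κ η : Kernel E E} {π : Measure E} (hκ : Kernel.Invariant κ π)
    (hη : Kernel.Invariant η π) : Kernel.Invariant (mixtureKernel t κ η) π := by
  unfold Kernel.Invariant
  ext A hA
  rw [Measure.bind_apply hA (Kernel.aemeasurable _)]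
  simp only [mixtureKernel_apply']
  have hm : Measurable fun z => ENNReal.ofReal (t : ℝ) * κ z A := (κ.measurable_coe hA).const_mul _
  rw [lintegral_add_left hm, lintegral_const_mul _ (κ.measurable_coe hA),
    lintegral_const_mul _ (η.measurable_coe hA), ← Measure.bind_apply hA (Kernel.aemeasurable _),
    ← Measure.bind_apply hA (Kernel.aemeasurable _), hκ.def, hη.def, ← add_mul, mixture_weights, one_mul]

/-- **MIXTURES OF REVERSIBLE KERNELS ARE REVERSIBLE.** [folklore: Tierney 1994 §2.4] -/
theorem isReversible_mixtureKernel (t : unitInterval) {κ η : Kernel E E} {π : Measure E}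
    (hκ : Kernel.IsReversible κ π) (hη : Kernel.IsReversible η π) :
    Kernel.IsReversible (mixtureKernel t κ η) π := by
  intro A B hA hB
  simp only [mixtureKernel_apply']
  have hmB : Measurable fun z => ENNReal.ofReal (t : ℝ) * κ z B := (κ.measurable_coe hB).const_mul _
  have hmA : Measurable fun z => ENNReal.ofReal (t : ℝ) * κ z A := (κ.measurable_coe hA).const_mul _
  rw [lintegral_add_left hmB, lintegral_add_left hmA, lintegral_const_mul _ (κ.measurable_coe hB),
    lintegral_const_mul _ (η.measurable_coe hB), lintegral_const_mul _ (κ.measurable_coe hA),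
    lintegral_const_mul _ (η.measurable_coe hA), hκ hA hB, hη hA hB]

end Mixture

end Summit.Ventures.LatticeQCDFlow.Scaling

end
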